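import Summits.BirchSwinnertonDyer.BirchSwinnertonDyer.Theorems.KatoDescentPotSupersingularKatoSelmerPTLocal
import Summits.BirchSwinnertonDyer.BirchSwinnertonDyer.Theorems.KatoDescentPotSupersingularTateDualLevelTransport
import Summits.BirchSwinnertonDyer.BirchSwinnertonDyer.Theorems.KatoDescentPotSupersingularSelmerMulKKummer
import Summits.BirchSwinnertonDyer.Rank1Residual.GaloisImage.PropagatedConditionCoisotropic
import Summits.BirchSwinnertonDyer.Rank1Residual.X11b.WeilTransport
import Summits.BirchSwinnertonDyer.Rank1Residual.X11b.LevelLiftingLower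
import Literature.NumberTheory.EllipticCurves.SelmerFiniteProofs
import HarnessLib

/-!
# The Poitou–Tate COKERNEL bound for Kato's `S(E[p^∞])`, I: orthogonal tuples of unramified classes lift to `S`
# (companion (ii) of brick (a) of crux M's level-0 ledger; the count `#Sel_{p^∞}·∏ #H¹_ur ≤ #S·[E(ℚ):p^K E(ℚ)]` is in part 44b `…KatoSelmerPTCokernel`)
# (route `KatoDescentPotSupersingular` / `…Tame…`, crux M = stmt-BirchSwinnertonDyer-19196; route-free helper)

Seat `bsd-potss-rkm` g19 (prover; cell `bsd-potss`), item stmt-BirchSwinnertonDyer-19196 (`--supports … --as helper`; closes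
nothing).  HONEST FRAMING: BSD is not proved by any of this; nothing is booked; theorems only (no definition, no named fact).  The
Poitou–Tate input is the FINITE-LEVEL `SelmerComplement` property of a family of local invariant maps (Milne I 4.10 (b), the tree's
predicate), carried as a hypothesis exactly as in the cell's other PT counts.

## What (memo `HOME/rkm/FINDING-19196-rkm-g19.md` §"What remains", steps P1–P4 assembled; Kato, Astérisque 295, §14.8 and proof of Prop. 14.16)

`S = H¹_{𝓤∞}(ℚ,E[p^∞]) ⊓ selmerLocalKerPrimary W ℚ_p p` (Kummer at `p`, unramified at `ℓ ≠ p`).  The map `Λ : S → ∏_{ℓ∈T∖p} H¹_ur(ℚ_ℓ,E[p^∞])` has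
kernel `⊇ Sel_{p^∞}(E/ℚ)` (part 43) and its COKERNEL is bounded by `[E(ℚ) : p^K E(ℚ)]` (`= #E(ℚ)[p^∞]` in rank `0`), whence the displayed
inequality — the direction crux M consumes (`#Ш[p^∞]·∏ c_ℓ^{(p)} ≤ #S·p^{t₀}` with g18's Néron reading `#H¹_ur = p^{v_p(c_ℓ)}`).
Proof at two finite levels `d = p^K` and `kd = p^s·p^K` (`i = inclKD`, `[p^s] = mulK`, `ι′ : E[p^s p^K] → E[p^∞]` of part 42, a level-`p^s p^K`
Weil datum with transport `w′` and descended pairing `desc`, a family `inv` at level `N = p^s p^K` with `IsPerfect` and `SelmerComplement`):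

* §1 `exists_selmer_map_weilDual_eq_of_mem_dualSelmerGroup` — every class `y` of the dual Selmer group of the Kummer structure at level
  `p^s p^K` is `w′_* c′` with `c′ ∈ Sel^{(p^s p^K)}(E/ℚ)` (Kummer self-duality, n1011 `dualTransported_kummerSelmerStructure_inr`; `H¹(ℝ, E[odd]) = 0`).
* §2 `localTatePairingZMod_map_inclKD_localization_weilDual` — `⟨i_* a, loc_ℓ (w′_* c′)⟩_ℓ = ⟨a, (desc^♭)_* loc_ℓ ([p^s]_* c′)⟩_ℓ` (part 40).
* §3 `exists_mem_kato_of_sum_eq_zero` — (★) a tuple `g = (g_ℓ)_{ℓ∈T∖p}`, `g_ℓ ∈ ι_K⁻¹ H¹_ur(ℚ_ℓ,E[p^∞])`, killed by the functionals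
  `x ↦ Σ_ℓ ⟨g_ℓ, (desc^♭)_* loc_ℓ x⟩_ℓ`, `x ∈ G₀ = Sel^{(p^K)} ⊓ ker(E[p^K] ↪ E)_*` (so, by §1–§2 and part 41 — `[p^s]_* Sel^{(p^s p^K)} ⊆ G₀` once `p^s`
  kills the relevant part of `Ш` — orthogonal to the whole dual Selmer group), lifts to `c ∈ S` with `loc_ℓ c = ι_K g_ℓ` (`SelmerComplement` (i) at
  level `p^s p^K`, then `c = ι′_* x′`, parts 42/43).  The count itself is part 44b.

References: K. Kato, Astérisque 295 (2004), §14.8 (p. 238), proof of Prop. 14.16 (pp. 244–245) [Kato2004Asterisque]; J. S. Milne, *ADT* I Thm. 4.10 (b),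
Cor. 2.3, Lemma 3.3, §6 [MilneADT2006]; B. Howard, Compos. Math. 140 (2004) Thm. 2.1.11 [Howard2004HeegnerKolyvagin]; R. Sakamoto, JTNB 36 (2024) §3
[Sakamoto2024].
-/

-- the summit and its single problem are both named `BirchSwinnertonDyer` (registry layout D-0017)
set_option linter.dupNamespace false
set_option autoImplicit false

noncomputable section

open scoped Classical ContRepresentation NumberField
open CategoryTheory Function Field NumberField IsDedekindDomain WeierstrassCurve
open Literature.NumberTheory.EllipticCurves Literature.NumberTheory.GaloisRepresentations
  Literature.NumberTheory.GaloisRepresentations.DiscreteGaloisModule Literature.NumberTheory.GaloisCohomology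
open Literature.NumberTheory.EllipticCurves.Kato2004
open Summit.BirchSwinnertonDyer.Rank1Residual.X11b.Levels Summit.BirchSwinnertonDyer.Rank1Residual.X11b.LocBridge
  Summit.BirchSwinnertonDyer.Rank1Residual.X11b.LevelKummer
open Summit.BirchSwinnertonDyer.Rank1Residual.GaloisImage
open Summit.BirchSwinnertonDyer.BirchSwinnertonDyer.Theorems.KummerTowerOrthogonal

universe u

namespace Summit.BirchSwinnertonDyer.BirchSwinnertonDyer.Theorems.KatoFiniteLevelCount

/-! ## §1 The setting at the two levels `p^K` and `p^s · p^K` -/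

section PT

variable (W : WeierstrassCurve ℚ) [W.IsElliptic] (p s k : ℕ) [Fact p.Prime]
  (T : Finset (HeightOneSpectrum (𝓞 ℚ)))
  (e : geomTorsion W ((p ^ s * p ^ k : ℕ) : ℤ) → geomTorsion W ((p ^ s * p ^ k : ℕ) : ℤ) → AlgebraicClosure ℚ)
  (hμ : ∀ S T, e S T ^ (p ^ s * p ^ k) = 1)
  (hadd₁ : ∀ S₁ S₂ T, e (S₁ + S₂) T = e S₁ T * e S₂ T)
  (hadd₂ : ∀ S T₁ T₂, e S (T₁ + T₂) = e S T₁ * e S T₂)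
  (hgal : ∀ (σ : absoluteGaloisGroup ℚ) (S T : geomTorsion W ((p ^ s * p ^ k : ℕ) : ℤ)), σ • e S T = e (σ • S) (σ • T))
  (inv : LocalInvariants ℚ (p ^ s * p ^ k))
  [Finite (geomTorsion W ((p ^ s * p ^ k : ℕ) : ℤ))] [Finite (geomTorsion W ((p ^ k : ℕ) : ℤ))]

omit [Finite (geomTorsion W ((p ^ k : ℕ) : ℤ))] in
/-- **The dual Selmer group of the Kummer structure is the Weil transport of the Selmer group**: every class `y` of
`H¹_{𝓚^*}(ℚ, E[p^s p^K]^D)` is `w′_* c′` with `c′ ∈ Sel^{(p^s p^K)}(E/ℚ)` (`p` odd) — Kummer self-duality at the finite places (n1011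
`dualTransported_kummerSelmerStructure_inr`, Tate's local duality + Euler characteristic), vanishing at `∞`.
[cite: MilneADT2006, Ch. I, Cor. 3.4 and §6 Lemma 6.15] [cite: Sakamoto2024, Def. 3.9 (p. 924)] -/
theorem exists_selmer_map_weilDual_eq_of_mem_dualSelmerGroup (hodd : p ≠ 2) (hk1 : 1 ≤ k)
    (halt : ∀ P, e P P = 1) (hnondeg : ∀ P, (∀ Q, e Q P = 1) → P = 0) (hperf : inv.IsPerfect)
    {y : galoisCohomology ((W.torsionGaloisModule ((p ^ s * p ^ k : ℕ) : ℤ)).tateDual (p ^ s * p ^ k)) 1}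
    (hy : y ∈ (inv.dualSelmerStructure (W.torsionGaloisModule ((p ^ s * p ^ k : ℕ) : ℤ))
      (W.kummerSelmerStructure ((p ^ s * p ^ k : ℕ) : ℤ))).selmerGroup) :
    haveI := neZero_pow p s; haveI := neZero_pow p k
    ∃ c ∈ selmerGroup W ((p ^ s * p ^ k : ℕ) : ℤ),
      galoisCohomology.map (weilDualIntertwining W (p ^ s * p ^ k) e hμ hadd₁ hadd₂ hgal) 1 c = y := by
  haveI := neZero_pow p s; haveI := neZero_pow p k
  have hp : p.Prime := Fact.out
  refine ⟨galoisCohomology.map (weilDualInv W (p ^ s * p ^ k) e hμ hadd₁ hadd₂ hgal hnondeg) 1 y, ?_,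
    map_weilDual_map_weilDualInv W (p ^ s * p ^ k) e hμ hadd₁ hadd₂ hgal hnondeg y⟩
  set c := galoisCohomology.map (weilDualInv W (p ^ s * p ^ k) e hμ hadd₁ hadd₂ hgal hnondeg) 1 y with hc
  have hyc : galoisCohomology.map (weilDualIntertwining W (p ^ s * p ^ k) e hμ hadd₁ hadd₂ hgal) 1 c = y :=
    map_weilDual_map_weilDualInv W (p ^ s * p ^ k) e hμ hadd₁ hadd₂ hgal hnondeg y
  have hyS := (SelmerStructure.mem_selmerGroup_iff _ _).1 hy
  rw [W.selmerGroup_eq_selmerGroup_kummerSelmerStructure]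
  refine (SelmerStructure.mem_selmerGroup_iff _ _).2 fun v => ?_
  rcases v with w | v
  · -- infinite place: `H¹(ℝ, E[odd]) = 0`
    have hodd' : Odd (((p ^ s * p ^ k : ℕ) : ℤ)) := by
      rw [← pow_add]; exact_mod_cast (hp.odd_of_ne_two hodd).pow
    have h0 := galoisCohomology_one_torsion_eq_zero_infinitePlace_of_odd W w hodd'
      (galoisCohomology.localization (W.torsionGaloisModule ((p ^ s * p ^ k : ℕ) : ℤ)) (Sum.inl w) 1 c)
    rw [h0]; exact zero_mem _
  · -- finite place: Kummer self-duality
    have hn : IsPrimePow (p ^ s * p ^ k) := by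
      rw [← pow_add]; exact hp.isPrimePow.pow (by omega)
    haveI : CharZero (v.adicCompletion ℚ) := charZero_adicCompletion v
    have hsd := dualTransported_kummerSelmerStructure_inr W ((p ^ s * p ^ k : ℕ)) e hμ hadd₁ hadd₂ hgal halt hnondeg hn v
      (localEulerPoincareCharacteristic_holds _) inv (hperf v).1.injective
    have hmem : galoisCohomology.localization (W.torsionGaloisModule ((p ^ s * p ^ k : ℕ) : ℤ)) (Sum.inr v) 1 c ∈
        inv.dualTransported (W.kummerSelmerStructure ((p ^ s * p ^ k : ℕ) : ℤ))
          (weilDualIntertwining W (p ^ s * p ^ k) e hμ hadd₁ hadd₂ hgal) (Sum.inr v) := by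
      rw [LocalInvariants.mem_dualTransported_iff]
      have h2 : DiscreteGaloisModule.localMap (weilDualIntertwining W (p ^ s * p ^ k) e hμ hadd₁ hadd₂ hgal) (Sum.inr v)
          (galoisCohomology.localization (W.torsionGaloisModule ((p ^ s * p ^ k : ℕ) : ℤ)) (Sum.inr v) 1 c) =
          galoisCohomology.localization _ (Sum.inr v) 1 y := by
        rw [← hyc]; exact (localization_map_one' _ (Sum.inr v) c).symm
      rw [h2]; exact hyS (Sum.inr v)
    rwa [hsd] at hmem

/-! ## §2 The level transport under the local Tate pairing -/

/-- **`⟨i_* a, loc_v (w′_* c′)⟩_v = ⟨a, (desc^♭)_* loc_v ([p^s]_* c′)⟩_v`** at a finite place `v`, for `a ∈ H¹(ℚ_v, E[p^K])` and a global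
`c′ ∈ H¹(ℚ, E[p^s p^K])` (`i = inclKD`, `w′` the Weil transport at level `p^s p^K`, `desc` the descended pairing on `E[p^K]`): adjointness
`⟨a, (i^D)_* b⟩ = ⟨i_* a, b⟩` (part 40) and `(i^D)_* w′_* = (desc^♭)_* [p^s]_*` (part 40), localisation commuting with both.
[cite: MilneADT2006, Ch. I §0 and Cor. 2.3] [cite: SilvermanAEC2009, Prop. III.8.1 (e)] -/
theorem localTatePairingZMod_map_inclKD_localization_weilDual (v : HeightOneSpectrum (𝓞 ℚ))
    (a : galoisCohomology ((W.torsionGaloisModule ((p ^ k : ℕ) : ℤ)).toLocal (Sum.inr v)) 1)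
    (c : galoisCohomology (W.torsionGaloisModule ((p ^ s * p ^ k : ℕ) : ℤ)) 1) :
    haveI := neZero_pow p s; haveI := neZero_pow p k
    localTatePairingZMod (W.torsionGaloisModule ((p ^ s * p ^ k : ℕ) : ℤ)) (p ^ s * p ^ k) (Sum.inr v) (inv (Sum.inr v))
        (galoisCohomology.map ((inclKD W (p ^ s) (p ^ k)).restrictField (v.adicCompletion ℚ)) 1 a)
        (galoisCohomology.localization ((W.torsionGaloisModule ((p ^ s * p ^ k : ℕ) : ℤ)).tateDual (p ^ s * p ^ k))
          (Sum.inr v) 1 (galoisCohomology.map (weilDualIntertwining W (p ^ s * p ^ k) e hμ hadd₁ hadd₂ hgal) 1 c)) =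
      localTatePairingZMod (W.torsionGaloisModule ((p ^ k : ℕ) : ℤ)) (p ^ s * p ^ k) (Sum.inr v) (inv (Sum.inr v)) a
        (galoisCohomology.map ((DiscreteGaloisModule.pairingDualIntertwining
            (ρ₁ := W.torsionGaloisModule ((p ^ k : ℕ) : ℤ)) (ρ₂ := W.torsionGaloisModule ((p ^ k : ℕ) : ℤ))
            (B := descendHom W (p ^ s) (p ^ k) e hμ hadd₁ hadd₂)
            (descendHom_smul W (p ^ s) (p ^ k) e hμ hadd₁ hadd₂ hgal)).restrictField (v.adicCompletion ℚ)) 1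
          (galoisCohomology.localization (W.torsionGaloisModule ((p ^ k : ℕ) : ℤ)) (Sum.inr v) 1
            (galoisCohomology.map (mulK W (p ^ s) (p ^ k)) 1 c))) := by
  haveI := neZero_pow p s; haveI := neZero_pow p k
  rw [localization_map_one', localization_map_one']
  have h := map_inclDual_map_weilDual_eq_map_descendDual_map_mulK_restrictField W (p ^ s) (p ^ k) e hμ hadd₁ hadd₂ hgal
    (Place.Completion (Sum.inr v : Place ℚ))
    (galoisCohomology.localization (W.torsionGaloisModule ((p ^ s * p ^ k : ℕ) : ℤ)) (Sum.inr v) 1 c)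
  have h' := localTatePairingZMod_map_tateDual_comp (p ^ s * p ^ k) (inclKD W (p ^ s) (p ^ k)) (Sum.inr v : Place ℚ)
    (inv (Sum.inr v)) a
    (galoisCohomology.map ((weilDualIntertwining W (p ^ s * p ^ k) e hμ hadd₁ hadd₂ hgal).restrictField
      (Place.Completion (Sum.inr v : Place ℚ))) 1
      (galoisCohomology.localization (W.torsionGaloisModule ((p ^ s * p ^ k : ℕ) : ℤ)) (Sum.inr v) 1 c))
  rw [h] at h'
  exact h'.symm

/-! ## §3 (★) Orthogonal tuples lift to `S` -/

/-- **(★) A tuple `g = (g_ℓ)_{ℓ ∈ T∖p}`, `g_ℓ ∈ ι_K⁻¹ H¹_ur(ℚ_ℓ, E[p^∞]) ⊆ H¹(ℚ_ℓ, E[p^K])`, killed by the functionals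
`x ↦ Σ_ℓ ⟨g_ℓ, (desc^♭)_* loc_ℓ x⟩_ℓ` (`x ∈ Sel^{(p^K)}(E/ℚ) ⊓ ker (E[p^K] ↪ E)_*`), lifts to Kato's `S`**: there is
`c ∈ S = H¹_{𝓤∞} ⊓ selmerLocalKerPrimary W ℚ_p p` with `loc_ℓ c = (ι_K)_* g_ℓ` for every `ℓ ∈ T∖p`.  Poitou–Tate (`SelmerComplement` (i)) at
level `p^s p^K` for the Kummer structure `𝓕 = 𝓚` and the relaxed structure `𝓖′` (Kummer at `p`, `ι′⁻¹ H¹_ur` at `ℓ ∈ T∖p`, unramified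
outside `T`), the orthogonality supplied by §1–§2 and part 41 (`p^s · Ш[p^∞] = 0`), the transport to `E[p^∞]` by `ι′` (parts 42/43).
[cite: Kato2004Asterisque, §14.8 (p. 238) and proof of Prop. 14.16 (pp. 244–245)] [cite: Howard2004HeegnerKolyvagin, Thm. 2.1.11 (arXiv:1202.6340 p. 6)]
[cite: MilneADT2006, Ch. I, Thm. 4.10 (b)] -/
theorem exists_mem_kato_of_sum_eq_zero (hodd : p ≠ 2) (hk1 : 1 ≤ k)
    (halt : ∀ P, e P P = 1) (hnondeg : ∀ P, (∀ Q, e Q P = 1) → P = 0) (hperf : inv.IsPerfect)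
    (hcompl : inv.SelmerComplement)
    (hpT : primePlace p ∈ T) (hT : ∀ v : HeightOneSpectrum (𝓞 ℚ), v ∉ T → W.HasGoodReductionAt v)
    (𝓤inf : SelmerStructure (primaryGaloisModule W p))
    (hUp : 𝓤inf (Sum.inr (primePlace p)) = ⊤)
    (hUur : ∀ v : HeightOneSpectrum (𝓞 ℚ), v ≠ primePlace p →
      𝓤inf (Sum.inr v) = unramifiedSubgroup (GaloisRep.toLocal v (primaryGaloisModule W p)) 1)
    (hUinl : ∀ w : InfinitePlace ℚ, 𝓤inf (Sum.inl w) = ⊤)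
    (𝓖' : SelmerStructure (W.torsionGaloisModule ((p ^ s * p ^ k : ℕ) : ℤ)))
    (hle : W.kummerSelmerStructure ((p ^ s * p ^ k : ℕ) : ℤ) ≤ 𝓖')
    (h𝓖good : ∀ v : HeightOneSpectrum (𝓞 ℚ), v ∉ T →
      𝓖' (Sum.inr v) = unramifiedSubgroup (GaloisRep.toLocal v (W.torsionGaloisModule ((p ^ s * p ^ k : ℕ) : ℤ))) 1)
    (h𝓖T : ∀ v ∈ T, v ≠ primePlace p →
      𝓖' (Sum.inr v) = (unramifiedSubgroup (GaloisRep.toLocal v (primaryGaloisModule W p)) 1).comap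
        (galoisCohomology.map (((primaryInclusion W p (s + k)).comp
          (W.torsionInclusion (natCast_pow_mul_pow_dvd_natCast_pow_add p s k))).restrictField (v.adicCompletion ℚ)) 1))
    (h𝓖p : 𝓖' (Sum.inr (primePlace p)) = W.kummerSelmerStructure ((p ^ s * p ^ k : ℕ) : ℤ) (Sum.inr (primePlace p)))
    (hs : ∀ a ∈ W.sha, ((p ^ s * p ^ k : ℕ) : ℤ) • a = 0 → p ^ s • a = 0)
    (g : ∀ ℓ : ↥(T \ {primePlace p}),
      ↥((unramifiedSubgroup (GaloisRep.toLocal ℓ.1 (primaryGaloisModule W p)) 1).comap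
        (galoisCohomology.map ((primaryInclusion W p k).restrictField (ℓ.1.adicCompletion ℚ)) 1)))
    (hg : haveI := neZero_pow p s; haveI := neZero_pow p k
      ∀ x ∈ selmerGroup W ((p ^ k : ℕ) : ℤ) ⊓ (torsionH1ToH1 W ((p ^ k : ℕ) : ℤ)).ker,
        ∑ ℓ : ↥(T \ {primePlace p}),
          localTatePairingZMod (W.torsionGaloisModule ((p ^ k : ℕ) : ℤ)) (p ^ s * p ^ k) (Sum.inr ℓ.1) (inv (Sum.inr ℓ.1))
            (g ℓ).1
            (galoisCohomology.map ((DiscreteGaloisModule.pairingDualIntertwining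
                (ρ₁ := W.torsionGaloisModule ((p ^ k : ℕ) : ℤ)) (ρ₂ := W.torsionGaloisModule ((p ^ k : ℕ) : ℤ))
                (B := descendHom W (p ^ s) (p ^ k) e hμ hadd₁ hadd₂)
                (descendHom_smul W (p ^ s) (p ^ k) e hμ hadd₁ hadd₂ hgal)).restrictField (ℓ.1.adicCompletion ℚ)) 1
              (galoisCohomology.localization (W.torsionGaloisModule ((p ^ k : ℕ) : ℤ)) (Sum.inr ℓ.1) 1 x)) = 0) :
    ∃ c ∈ 𝓤inf.selmerGroup ⊓ selmerLocalKerPrimary W ((primePlace p).adicCompletion ℚ) p,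
      ∀ ℓ : ↥(T \ {primePlace p}),
        galoisCohomology.localization (primaryGaloisModule W p) (Sum.inr ℓ.1) 1 c =
          galoisCohomology.map ((primaryInclusion W p k).restrictField (ℓ.1.adicCompletion ℚ)) 1 (g ℓ).1 := by
  classical
  haveI := neZero_pow p s; haveI := neZero_pow p k
  have hp : p.Prime := Fact.out
  -- the places of `T ∖ p`
  have hι : ∀ ℓ : ↥(T \ {primePlace p}), ℓ.1 ∈ T ∧ ℓ.1 ≠ primePlace p := fun ℓ => by
    have h := Finset.mem_sdiff.1 ℓ.2
    exact ⟨h.1, fun h' => h.2 (Finset.mem_singleton.2 h')⟩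
  have hpℓ : ∀ ℓ : ↥(T \ {primePlace p}), ((p : ℕ) : 𝓞 ℚ) ∉ ℓ.1.asIdeal := fun ℓ =>
    natCast_not_mem_of_ne_primePlace p (hι ℓ).2
  -- the Poitou–Tate set `S_PT = {∞} ∪ T`
  set SPT : Finset (Place ℚ) :=
    (Finset.univ : Finset (InfinitePlace ℚ)).image (Sum.inl : InfinitePlace ℚ → Place ℚ) ∪
      T.image (Sum.inr : HeightOneSpectrum (𝓞 ℚ) → Place ℚ) with hSPT
  have hSinl : ∀ w : InfinitePlace ℚ, (Sum.inl w : Place ℚ) ∈ SPT := fun w =>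
    Finset.mem_union.2 (Or.inl (Finset.mem_image.2 ⟨w, Finset.mem_univ _, rfl⟩))
  have hSinr : ∀ v : HeightOneSpectrum (𝓞 ℚ), (Sum.inr v : Place ℚ) ∈ SPT ↔ v ∈ T := fun v => by
    constructor
    · intro h
      rcases Finset.mem_union.1 h with h | h
      · obtain ⟨w, -, hw⟩ := Finset.mem_image.1 h
        exact absurd hw Sum.inl_ne_inr
      · obtain ⟨ℓ, hℓ, hℓv⟩ := Finset.mem_image.1 h
        exact Sum.inr_injective hℓv ▸ hℓ
    · intro h
      exact Finset.mem_union.2 (Or.inr (Finset.mem_image.2 ⟨v, h, rfl⟩))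
  -- the data of `SelmerComplement`
  have hM : ∀ m : geomTorsion W ((p ^ s * p ^ k : ℕ) : ℤ), (p ^ s * p ^ k) • m = 0 := fun m =>
    Subtype.ext (by
      rw [AddSubgroupClass.coe_nsmul, ZeroMemClass.coe_zero, ← natCast_zsmul]
      exact (W.mem_geomTorsion_iff _ (m : W.geomPoints)).mp m.2)
  have hS : ∀ v : HeightOneSpectrum (𝓞 ℚ), (Sum.inr v : Place ℚ) ∉ SPT →
      (((p ^ s * p ^ k : ℕ) : ℕ) : 𝓞 ℚ) ∉ v.asIdeal ∧
        GaloisRep.IsUnramifiedAt v (W.torsionGaloisModule ((p ^ s * p ^ k : ℕ) : ℤ)) := by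
    intro v hv
    have hvT : v ∉ T := fun h => hv ((hSinr v).2 h)
    have hpv : ((p : ℕ) : 𝓞 ℚ) ∉ v.asIdeal := natCast_not_mem_of_ne_primePlace p (fun h => hvT (h ▸ hpT))
    have hNv : (((p ^ s * p ^ k : ℕ) : ℕ) : 𝓞 ℚ) ∉ v.asIdeal := by
      rw [← pow_add, Nat.cast_pow]
      exact fun h => hpv (v.isPrime.mem_of_pow_mem _ h)
    refine ⟨hNv, Rank1Residual.X11b.AcSelmer.isUnramifiedAt_torsionGaloisModule W (hT v hvT) ?_⟩
    rw [Int.cast_natCast]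
    exact hNv
  have h𝓕ur : (W.kummerSelmerStructure ((p ^ s * p ^ k : ℕ) : ℤ)).IsUnramifiedOutside SPT :=
    ⟨hSinl, fun v hv => by
      have hvT : v ∉ T := fun h => hv ((hSinr v).2 h)
      exact kummerSelmerStructure_inr_eq_unramifiedSubgroup_pow_mul_pow W p s k
        (natCast_not_mem_of_ne_primePlace p (fun h => hvT (h ▸ hpT))) (hT v hvT)⟩
  have h𝓖ur : 𝓖'.IsUnramifiedOutside SPT :=
    ⟨hSinl, fun v hv => h𝓖good v (fun h => hv ((hSinr v).2 h))⟩
  -- the tuple `t = (i_* g_ℓ)_ℓ`, extended by `0`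
  let t : ∀ v : Place ℚ, galoisCohomology ((W.torsionGaloisModule ((p ^ s * p ^ k : ℕ) : ℤ)).toLocal v) 1 := fun v =>
    match v with
    | Sum.inl _ => 0
    | Sum.inr ℓ =>
      if h : ℓ ∈ T \ {primePlace p} then
        galoisCohomology.map ((inclKD W (p ^ s) (p ^ k)).restrictField (ℓ.adicCompletion ℚ)) 1 (g ⟨ℓ, h⟩).1
      else 0
  have ht_inr : ∀ ℓ : ↥(T \ {primePlace p}), t (Sum.inr ℓ.1) =
      galoisCohomology.map ((inclKD W (p ^ s) (p ^ k)).restrictField (ℓ.1.adicCompletion ℚ)) 1 (g ℓ).1 := fun ℓ => by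
    show dite _ _ _ = _
    rw [dif_pos ℓ.2]
  have ht : ∀ v ∈ SPT, t v ∈ 𝓖' v := by
    intro v _
    rcases v with w | ℓ
    · exact zero_mem _
    · by_cases h : ℓ ∈ T \ {primePlace p}
      · obtain ⟨ℓ', rfl⟩ : ∃ ℓ' : ↥(T \ {primePlace p}), ℓ'.1 = ℓ := ⟨⟨ℓ, h⟩, rfl⟩
        have hmem : galoisCohomology.map (((primaryInclusion W p (s + k)).comp
            (W.torsionInclusion (natCast_pow_mul_pow_dvd_natCast_pow_add p s k))).restrictField
              (ℓ'.1.adicCompletion ℚ)) 1 (t (Sum.inr ℓ'.1)) ∈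
            unramifiedSubgroup (GaloisRep.toLocal ℓ'.1 (primaryGaloisModule W p)) 1 := by
          rw [ht_inr ℓ', map_iotaPrime_map_inclKD_restrictField]
          exact (g ℓ').2
        rw [h𝓖T ℓ'.1 (hι ℓ').1 (hι ℓ').2]
        exact hmem
      · have h0 : t (Sum.inr ℓ) = 0 := dif_neg h
        rw [h0]; exact zero_mem _
  -- orthogonality to the dual Selmer group of `𝓚`
  have horth : ∀ y ∈ (inv.dualSelmerStructure (W.torsionGaloisModule ((p ^ s * p ^ k : ℕ) : ℤ))
      (W.kummerSelmerStructure ((p ^ s * p ^ k : ℕ) : ℤ))).selmerGroup,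
      ∑ v ∈ SPT, localTatePairingZMod (W.torsionGaloisModule ((p ^ s * p ^ k : ℕ) : ℤ)) (p ^ s * p ^ k) v (inv v) (t v)
        (galoisCohomology.localization ((W.torsionGaloisModule ((p ^ s * p ^ k : ℕ) : ℤ)).tateDual (p ^ s * p ^ k)) v 1 y) = 0 := by
    intro y hy
    obtain ⟨c', hc', rfl⟩ :=
      exists_selmer_map_weilDual_eq_of_mem_dualSelmerGroup W p s k e hμ hadd₁ hadd₂ hgal inv hodd hk1 halt hnondeg hperf hy
    have hx : galoisCohomology.map (mulK W (p ^ s) (p ^ k)) 1 c' ∈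
        selmerGroup W ((p ^ k : ℕ) : ℤ) ⊓ (torsionH1ToH1 W ((p ^ k : ℕ) : ℤ)).ker :=
      map_mulK_selmerGroup_le W (p ^ s) (p ^ k) hs ⟨c', hc', rfl⟩
    have hBsub : (T \ {primePlace p}).image (Sum.inr : HeightOneSpectrum (𝓞 ℚ) → Place ℚ) ⊆ SPT := by
      intro v hv
      obtain ⟨ℓ, hℓ, rfl⟩ := Finset.mem_image.1 hv
      exact (hSinr ℓ).2 (Finset.mem_sdiff.1 hℓ).1
    rw [← Finset.sum_subset hBsub, Finset.sum_image fun a _ b _ h => Sum.inr_injective h, ← Finset.sum_coe_sort]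
    · refine Eq.trans (Finset.sum_congr rfl fun ℓ _ => ?_) (hg _ hx)
      rw [ht_inr ℓ]
      exact localTatePairingZMod_map_inclKD_localization_weilDual W p s k e hμ hadd₁ hadd₂ hgal inv ℓ.1 (g ℓ).1 c'
    · intro v _ hvB
      rcases v with w | ℓ
      · have h0 : t (Sum.inl w) = 0 := rfl
        rw [h0, map_zero, AddMonoidHom.zero_apply]
      · have hℓ : ℓ ∉ T \ {primePlace p} := fun h => hvB (Finset.mem_image.2 ⟨ℓ, h, rfl⟩)
        have h0 : t (Sum.inr ℓ) = 0 := dif_neg hℓ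
        rw [h0, map_zero, AddMonoidHom.zero_apply]
  -- Poitou–Tate
  obtain ⟨x', hx'𝓖, hx't⟩ := (hcompl (W.torsionGaloisModule ((p ^ s * p ^ k : ℕ) : ℤ)) hM SPT hS
    (W.kummerSelmerStructure ((p ^ s * p ^ k : ℕ) : ℤ)) 𝓖' hle h𝓕ur h𝓖ur).1 t ht horth
  have hx'loc := (SelmerStructure.mem_selmerGroup_iff _ _).1 hx'𝓖
  -- `c = ι′_* x′`: `loc_ℓ c = ι_K g_ℓ` at `ℓ ∈ T ∖ p`
  have hloc : ∀ ℓ : ↥(T \ {primePlace p}),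
      galoisCohomology.localization (primaryGaloisModule W p) (Sum.inr ℓ.1) 1
          (galoisCohomology.map ((primaryInclusion W p (s + k)).comp
            (W.torsionInclusion (natCast_pow_mul_pow_dvd_natCast_pow_add p s k))) 1 x') =
        galoisCohomology.map ((primaryInclusion W p k).restrictField (ℓ.1.adicCompletion ℚ)) 1 (g ℓ).1 := fun ℓ => by
    have h1 := localization_map_one' ((primaryInclusion W p (s + k)).comp
      (W.torsionInclusion (natCast_pow_mul_pow_dvd_natCast_pow_add p s k))) (Sum.inr ℓ.1 : Place ℚ) x'
    have h2 := (AddMonoidHom.mem_ker).1 (kummerLocalConditionAt_le_ker_map_iotaPrime W p s k ℓ.1 (hpℓ ℓ)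
      (hx't (Sum.inr ℓ.1) ((hSinr ℓ.1).2 (hι ℓ).1)))
    have h3 := sub_eq_zero.1 ((map_sub (galoisCohomology.map (((primaryInclusion W p (s + k)).comp
      (W.torsionInclusion (natCast_pow_mul_pow_dvd_natCast_pow_add p s k))).restrictField
        (ℓ.1.adicCompletion ℚ)) 1) _ _).symm.trans h2)
    rw [ht_inr ℓ, map_iotaPrime_map_inclKD_restrictField] at h3
    exact h1.trans h3
  refine ⟨galoisCohomology.map ((primaryInclusion W p (s + k)).comp
    (W.torsionInclusion (natCast_pow_mul_pow_dvd_natCast_pow_add p s k))) 1 x', ⟨?_, ?_⟩, hloc⟩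
  · -- `c ∈ H¹_{𝓤∞}`
    refine (SelmerStructure.mem_selmerGroup_iff _ _).2 fun v => ?_
    rcases v with w | v
    · rw [hUinl]; exact AddSubgroup.mem_top _
    · by_cases hvp : v = primePlace p
      · subst hvp; rw [hUp]; exact AddSubgroup.mem_top _
      · rw [hUur v hvp]
        by_cases hvT : v ∈ T
        · have hvι : v ∈ T \ {primePlace p} :=
            Finset.mem_sdiff.2 ⟨hvT, fun h => hvp (Finset.mem_singleton.1 h)⟩
          rw [hloc ⟨v, hvι⟩]
          exact (g ⟨v, hvι⟩).2
        · -- a good place `v ∉ T`: `loc_v x′ ∈ 𝓖′_v = H¹_ur = 𝓚_v ≤ ker ι′_*`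
          have hpv : ((p : ℕ) : 𝓞 ℚ) ∉ v.asIdeal := natCast_not_mem_of_ne_primePlace p hvp
          have h4 : galoisCohomology.localization (W.torsionGaloisModule ((p ^ s * p ^ k : ℕ) : ℤ)) (Sum.inr v) 1 x' ∈
              W.kummerSelmerStructure ((p ^ s * p ^ k : ℕ) : ℤ) (Sum.inr v) := by
            have h5 := hx'loc (Sum.inr v)
            rw [h𝓖good v hvT, ← kummerSelmerStructure_inr_eq_unramifiedSubgroup_pow_mul_pow W p s k hpv (hT v hvT)] at h5
            exact h5
          have h6 := (AddMonoidHom.mem_ker).1 (kummerLocalConditionAt_le_ker_map_iotaPrime W p s k v hpv h4)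
          have h7 : galoisCohomology.map (((primaryInclusion W p (s + k)).comp
              (W.torsionInclusion (natCast_pow_mul_pow_dvd_natCast_pow_add p s k))).restrictField
                (Place.Completion (Sum.inr v : Place ℚ))) 1
              (galoisCohomology.localization (W.torsionGaloisModule ((p ^ s * p ^ k : ℕ) : ℤ)) (Sum.inr v) 1 x') = 0 := h6
          rw [localization_map_one', h7]
          exact zero_mem _
  · -- `c` is Kummer at `p`
    have h7 := hx'loc (Sum.inr (primePlace p))
    rw [h𝓖p] at h7
    exact map_iotaPrime_mem_selmerLocalKerPrimary W p s k (Sum.inr (primePlace p)) h7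

end PT

end Summit.BirchSwinnertonDyer.BirchSwinnertonDyer.Theorems.KatoFiniteLevelCount

end
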